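import Mathlib
import Summits.KontsevichZagierPeriods.KontsevichZagierPeriods.Theses.TorsionLogs
import Summits.KontsevichZagierPeriods.KontsevichZagierPeriods.Theorems.TorsionLogsNeronTorsionSectorAssemblyMain

/-!
# F3 — specialisation evidence for the rung `NeronTorsionHeightChain` (line `NeronHeight`)

FLOOR (`g1-KontsevichZagierPeriods-17981`): `TorsionLogs.NeronTorsionPrimitiveChain`, proved by
`Cruxes.NeronTorsionSector.Translation.stub_assembly` (axiom-clean).  The rung keeps every binder and
every hypothesis of the floor and its whole conclusion, and ADDS one conjunct pinning the log carrier: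
`4N(N−2)·c·log B = q²·(4·log|ψ_{N−1}(x_P, y_P/2)| − N(N−2)·log(3e₁² − g₂/4))`.

Honest containment statement (brief F3): the rung is STRONGER than the floor at every parameter value,
so the floor is not a `simpa` instance of the rung at some index; what is literal is the DOWNWARD
specialisation (2): `rung → floor` by forgetting the pin (kernel `specialises` direction `Rung → Ftype`).
(1) is the floor by name (the BC5/T3 witness of the ladder — no case of `KontsevichZagierPeriods` is a
theorem, so the floor lies outside `S`'s known regime); (3)–(4) certify the two constants of the pin:
`ψ₂(x, y/2) = y` (the flex case `N = 3`, where the pin reads `c·log B = 12·log|y_P| − 9·log 5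
= 3·log(f(x_P)²/125)`, the carrier of the open crux `TorsionLogs.NeronTorsionFlex`; the kernel-checked
composition is `Lines/NeronHeight.lean :: NeronTorsionFlex_of`) and `Ψ₃(e₁) = −(3e₁² − g₂/4)²`
(whence `λ̃(ω₁/2) = log|ψ₃(e₁)|/8 = ¼·log(3e₁² − g₂/4)`).
-/

-- single-conjunct summit: Sub = Summit, so the namespace segment repeats by design (CONVENTIONS §2)
set_option linter.dupNamespace false

namespace Summit.KontsevichZagierPeriods.KontsevichZagierPeriods.Cruxes.NeronTorsionFlex.NeronHeight.Special

open Literature.NumberTheory.Transcendental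
open Summit.KontsevichZagierPeriods.KontsevichZagierPeriods

/-- The rung, verbatim `Lines/NeronHeight.lean :: NeronTorsionHeightChain`. -/
def NeronTorsionHeightChain : Prop :=
  ∀ (g₂ g₃ e₁ xP yP : ℝ) (N a p q : ℕ) (f : ℝ → ℝ), (∀ x, f x = 4 * x ^ 3 - g₂ * x - g₃) →
    g₂ ^ 3 - 27 * g₃ ^ 2 ≠ 0 → f e₁ = 0 → 0 < e₁ → (∀ x, e₁ < x → 0 < f x) → e₁ < xP →
    yP ^ 2 = f xP → 3 ≤ N → 0 < a → 2 * a < N →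
    (∀ hns : (⟨0, 0, 0, -g₂ / 4, -g₃ / 4⟩ : WeierstrassCurve ℝ).toAffine.Nonsingular xP (yP / 2),
      addOrderOf (WeierstrassCurve.Affine.Point.some xP (yP / 2) hns) = N) →
    (N : ℝ) * (∫ x in Set.Ioi xP, (Real.sqrt (f x))⁻¹) =
      a * (2 * ∫ x in Set.Ioi e₁, (Real.sqrt (f x))⁻¹) →
    Nat.Coprime p q → (q : ℤ) * ((N : ℤ) - 2 * (a : ℤ)) = (p : ℤ) * (2 * (N : ℤ)) →
    ∀ (rI rP : KZ.IntegralRep 2),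
      rI.domain = {z | e₁ < z 1 ∧ z 1 < z 0 ∧ z 0 < xP} →
      Set.EqOn rI.integrand (fun z => z 1 / (Real.sqrt (f (z 1)) * Real.sqrt (f (z 0)))) rI.domain →
      rP.domain = {z | e₁ < z 0 ∧ e₁ < z 1} →
      Set.EqOn rP.integrand
        (fun z => (Real.sqrt (f (z 0)))⁻¹ * ((g₂ * z 1 + 2 * g₃) / (2 * (z 1) ^ 2 * Real.sqrt (f (z 1)))))
        rP.domain →
      ∃ (c : ℤ) (B : ℝ) (rB : KZ.IntegralRep 1), 1 < B ∧ IsAlgebraic ℚ B ∧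
        rB.domain = {t | 1 < t 0 ∧ t 0 < B} ∧ Set.EqOn rB.integrand (fun t => (t 0)⁻¹) rB.domain ∧
        ((q : ℤ) ^ 2) • KZ.of rI + ((p : ℤ) ^ 2) • KZ.of rP - c • KZ.of rB ∈ KZ.relations ∧
        4 * (N : ℝ) * ((N : ℝ) - 2) * ((c : ℝ) * Real.log B) =
          (q : ℝ) ^ 2 * (4 * Real.log
              |((⟨0, 0, 0, -g₂ / 4, -g₃ / 4⟩ : WeierstrassCurve ℝ).ψ ((N : ℤ) - 1)).evalEval xP (yP / 2)|
            - (N : ℝ) * ((N : ℝ) - 2) * Real.log (3 * e₁ ^ 2 - g₂ / 4))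

/-- (1) The floor, by name (witness of weakness for the ladder). -/
example : Theses.TorsionLogs.NeronTorsionPrimitiveChain :=
  Cruxes.NeronTorsionSector.Translation.stub_assembly

/-- (2) Downward specialisation: the rung implies the floor item verbatim (forget the pin). -/
example (h : NeronTorsionHeightChain) : Theses.TorsionLogs.NeronTorsionPrimitiveChain := by
  intro g₂ g₃ e₁ xP yP N a p q f hf hΔ hfe he₁ hpos hxP hyP hN ha haN htor hper hpq htie rI rP hId hIi
    hPd hPi
  obtain ⟨c, B, rB, h1, h2, h3, h4, h5, -⟩ :=
    h g₂ g₃ e₁ xP yP N a p q f hf hΔ hfe he₁ hpos hxP hyP hN ha haN htor hper hpq htie rI rP hId hIi hPd hPi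
  exact ⟨c, B, rB, h1, h2, h3, h4, h5⟩

/-- (3) The flex constant: for `N = 3` the pinned division value is `ψ₂(x, y/2) = y`. -/
example (g₂ g₃ x y : ℝ) :
    (((⟨0, 0, 0, -g₂ / 4, -g₃ / 4⟩ : WeierstrassCurve ℝ).ψ (((3 : ℕ) : ℤ) - 1)).evalEval x (y / 2)) = y := by
  have hidx : (((3 : ℕ) : ℤ) - 1) = 2 := by norm_num
  rw [hidx, WeierstrassCurve.ψ_two, WeierstrassCurve.ψ₂, WeierstrassCurve.Affine.evalEval_polynomialY]
  simp only [zero_mul, add_zero]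
  ring

/-- (4) The base-point constant: `Ψ₃(e₁) = −(3e₁² − g₂/4)²` at a root `e₁` of `f = 4x³ − g₂x − g₃`
(so `λ̃(ω₁/2) = log|ψ₃(e₁, 0)|/8 = ¼·log(3e₁² − g₂/4)`). -/
example (g₂ g₃ e₁ : ℝ) (hfe : 4 * e₁ ^ 3 - g₂ * e₁ - g₃ = 0) :
    ((⟨0, 0, 0, -g₂ / 4, -g₃ / 4⟩ : WeierstrassCurve ℝ).Ψ₃).eval e₁ = -(3 * e₁ ^ 2 - g₂ / 4) ^ 2 := by
  simp only [WeierstrassCurve.Ψ₃, WeierstrassCurve.b₂, WeierstrassCurve.b₄, WeierstrassCurve.b₆,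
    WeierstrassCurve.b₈, Polynomial.eval_add, Polynomial.eval_mul, Polynomial.eval_C, Polynomial.eval_pow,
    Polynomial.eval_X, Polynomial.eval_ofNat]
  linear_combination (3 * e₁) * hfe

/-- (5) The flex pin bookkeeping: `12·(c·log B) = 36·(4·(log f)/2 − 3·log 5)` is
`c·log B = 3·(2·log f − 3·log 5)`. -/
example (e Lf L5 : ℝ) (h : 4 * (3 : ℝ) * (3 - 2) * e = (6 : ℝ) ^ 2 * (4 * (Lf / 2) - 3 * (3 - 2) * L5)) :
    e = 3 * (2 * Lf - 3 * L5) := by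
  linarith

end Summit.KontsevichZagierPeriods.KontsevichZagierPeriods.Cruxes.NeronTorsionFlex.NeronHeight.Special
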